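import Literature.Computability.Cryptography.InfrastructureNavigation
import HarnessLib

/-!
# Navigating an infrastructure with a `k`-gap: the consumers of `GiantStepCycle.two_gap`, generalised

Topic `Computability/Cryptography`; companion of `InfrastructureNavigation.lean` (Jozsa 2003, Thm. 5:
the walk `start` / `dbl` / `descent` / `final` of an abstract infrastructure `WalkData` with
`η`-accurate rational distance evaluators) and of `HallgrenCandidateCheck.lean`.
Theorem-only file over the tree's `WalkData` (no structure, no named fact).

The abstract infrastructure `GiantStepCycle` of `InfrastructureNavigation.lean` carries the axiom
`two_gap : ∀ m, L ≤ P (m + 2) - P m` — two consecutive gaps of the principal cycle of a REAL QUADRATIC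
order exceed `ln 2` (Jozsa 2003, Prop. 32). Along Voronoi's chain of relative minima of a COMPLEX CUBIC
order (unit rank one; Williams–Dueck–Schmid 1983, Buchmann–Williams 1988) only a SIX-gap holds: at most
six minima have their real conjugate in one dyadic range, so `P (m + 6) - P m ≥ ln 2`, while single,
double, …, quintuple gaps may be tiny. This file re-proves, over a bare `W : WalkData ι` together with
HYPOTHESES — true positions `P : ℤ → ℝ`, labels `lab : ℤ → ι`, `rho_lab`, the `η`-accuracy of `ghat`,
and a `k`-gap `∀ m, L ≤ P (m + k) - P m` — exactly the consumers of `two_gap` in the tree, with `2`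
replaced by `k`:

* `kgap_babySteps_ge` (← `two_babySteps_ge`): `k` baby steps advance the computed distance by
  `≥ L - kη`; `kgap_iterate_babyStep_ge` (← `iterate_babyStep_ge`): `k i` steps advance by `≥ i (L - kη)`;
* `kgap_start_ge_of_lt`, `kgap_le_start` (← `start_ge_of_lt`, `le_start`): the start-up freezes after
  `k j` rounds once `2K + 1 ≤ j (L - kη)`;
* `kgap_lt_final_babyStep` (← `lt_final_babyStep`): with `B = k M` final rounds and
  `M (L - kη) > Res` the next baby step passes the target;
* `kgap_window` (← the use of `two_gap` in `HallgrenCandidateCheck.passes_complete`): a position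
  strictly between `P m` and `P (m + 1) + L` has index in `(m, m + k]`, so the candidate check must
  inspect the shifts `j ≤ k`;
* `kgap_count`, `kgap_le_mul_R` (new, free of any arithmetic): `n L ≤ k R` — at most `k R / L` ideals per
  period and `R ≥ L / k` (for the cubic chain: `R ≥ (ln 2)/6` with no Artin-type unit bound).

The last section records that the tree's `GiantStepCycle` supplies these hypotheses at `k = 2`
(`GiantStepCycle.kgap_two`) and derives the one consequence that is new even there,
`GiantStepCycle.card_mul_L_le_two_mul_R` (`p ln 2 ≤ 2R`). (Re-deriving the tree's own
`two_babySteps_ge`, `iterate_babyStep_ge`, `start_ge_of_lt`, `le_start`, `lt_final_babyStep` from the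
`k`-gap lemmas is a one-line `simpa` each; those duplicates were checked and are deliberately NOT
restated here.)

## References

* R. Jozsa, *Notes on Hallgren's efficient quantum algorithm for solving Pell's equation*,
  arXiv:quant-ph/0302134 (2003), §7 Prop. 32, §9 Thm. 5, §10 (c). [Jozsa2003]
* J. Buchmann, H. C. Williams, *On the infrastructure of the principal ideal class of an algebraic
  number field of unit rank one*, Math. Comp. 50 (1988), 569–579,
  doi:10.1090/s0025-5718-1988-0929554-6. [BuchmannWilliams1988Infrastructure] (NOT the tree's bib key
  `BuchmannWilliams1988`, which is the J. Cryptology key-exchange paper.)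
* H. C. Williams, G. W. Dueck, B. K. Schmid, *A rapid method of evaluating the regulator and class
  number of a pure cubic field*, Math. Comp. 41 (1983), 235–286,
  doi:10.1090/s0025-5718-1983-0701638-2. [WilliamsDueckSchmid1983]
-/

noncomputable section

namespace Literature.Computability.Cryptography

namespace WalkData

variable {ι : Type*} (W : WalkData ι)
variable {P : ℤ → ℝ} {lab : ℤ → ι} {η L : ℝ} {k : ℕ}

/-! ### Tracking baby steps against the true positions -/

/-- After `j` baby steps from the ideal `lab m` the label is `lab (m + j)`. [cite: Jozsa2003, §9 (δ(I, ρI) = ln γ)] -/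
theorem iterate_babyStep_fst (hrho : ∀ m, W.rho (lab m) = lab (m + 1)) {s : St ι} {m : ℤ}
    (hs : lab m = s.1) (j : ℕ) : ((W.babyStep)^[j] s).1 = lab (m + j) := by
  induction j with
  | zero => simp [hs]
  | succ j ih =>
    rw [Function.iterate_succ_apply', babyStep]
    dsimp only
    rw [ih, hrho]
    push_cast
    ring_nf

/-- The computed distance after `j` baby steps is within `j η` of the true advance
`P (m + j) - P m`. [cite: Jozsa2003, §9 Thm. 5 (accuracy of the accumulated distances)] -/
theorem iterate_babyStep_snd_bounds (hrho : ∀ m, W.rho (lab m) = lab (m + 1))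
    (hghat : ∀ m, |(W.ghat (lab m) : ℝ) - (P (m + 1) - P m)| ≤ η) {s : St ι} {m : ℤ}
    (hs : lab m = s.1) (j : ℕ) :
    (s.2 : ℝ) + (P (m + j) - P m) - j * η ≤ (((W.babyStep)^[j] s).2 : ℝ) ∧
      (((W.babyStep)^[j] s).2 : ℝ) ≤ s.2 + (P (m + j) - P m) + j * η := by
  induction j with
  | zero => simp
  | succ j ih =>
    have hl := W.iterate_babyStep_fst hrho hs j
    have hg := hghat (m + j)
    rw [← hl] at hg
    rw [Function.iterate_succ_apply']
    simp only [babyStep, Rat.cast_add]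
    rw [abs_le] at hg
    have e : (m + ((j + 1 : ℕ) : ℤ)) = m + j + 1 := by push_cast; ring
    rw [e]
    push_cast
    constructor <;> linarith [ih.1, ih.2, hg.1, hg.2]

/-! ### The `k`-gap replaces the double gap -/

/-- **`k` baby steps advance the computed distance by at least `L - kη`** (the `k`-gap analogue of
`GiantStepCycle.two_babySteps_ge`). [cite: Jozsa2003, §7 Prop. 32] [cite: BuchmannWilliams1988Infrastructure] -/
theorem kgap_babySteps_ge (hrho : ∀ m, W.rho (lab m) = lab (m + 1))
    (hghat : ∀ m, |(W.ghat (lab m) : ℝ) - (P (m + 1) - P m)| ≤ η)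
    (hgap : ∀ m, L ≤ P (m + k) - P m) {s : St ι} (hs : ∃ m, lab m = s.1) :
    (s.2 : ℝ) + (L - k * η) ≤ (((W.babyStep)^[k] s).2 : ℝ) := by
  obtain ⟨m, hm⟩ := hs
  have h := (W.iterate_babyStep_snd_bounds hrho hghat hm k).1
  have hg := hgap m
  linarith

/-- **`k i` plain baby steps advance the computed distance by at least `i (L - kη)`** (the analogue of
`GiantStepCycle.iterate_babyStep_ge`). [cite: Jozsa2003, §7 Prop. 32] -/
theorem kgap_iterate_babyStep_ge (hrho : ∀ m, W.rho (lab m) = lab (m + 1))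
    (hghat : ∀ m, |(W.ghat (lab m) : ℝ) - (P (m + 1) - P m)| ≤ η)
    (hgap : ∀ m, L ≤ P (m + k) - P m) {J : St ι} (hJ : ∃ m, lab m = J.1) (i : ℕ) :
    (J.2 : ℝ) + i * (L - k * η) ≤ ((((W.babyStep)^[k * i]) J).2 : ℝ) := by
  induction i with
  | zero => simp
  | succ i ih =>
    have hJ' : ∃ m, lab m = ((W.babyStep)^[k * i] J).1 := by
      obtain ⟨m, hm⟩ := hJ
      exact ⟨m + (k * i : ℕ), (W.iterate_babyStep_fst hrho hm (k * i)).symm⟩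
    have h := W.kgap_babySteps_ge hrho hghat hgap hJ'
    rw [show k * (i + 1) = k + k * i by ring, Function.iterate_add_apply]
    push_cast
    linarith

/-! ### Phase 0 with a `k`-gap: the start-up freezes after `k j` rounds -/

/-- The start-up states are ideals of the cycle. [folklore] -/
theorem start_fst_mem (hrho : ∀ m, W.rho (lab m) = lab (m + 1)) (hunit : lab 0 = W.unit) (j : ℕ) :
    ∃ m, lab m = (W.start j).1 := by
  induction j with
  | zero => exact ⟨0, by simp [start, hunit]⟩
  | succ j ih =>
    obtain ⟨m, hm⟩ := ih
    rw [start, Function.iterate_succ_apply', ← start]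
    unfold startStep
    split_ifs
    · refine ⟨m + 1, ?_⟩
      rw [babyStep]
      dsimp only
      rw [← hm, hrho]
    · exact ⟨m, hm⟩

/-- A frozen start-up state stays frozen (as `GiantStepCycle.startStep_of_le`, on `WalkData`). [folklore] -/
theorem startStep_of_le' {s : St ι} (h : 2 * W.K + 1 ≤ s.2) : W.startStep s = s := by
  simp [startStep, not_lt.mpr h]

/-- While not frozen, `k j` start-up rounds advance the computed distance by at least `j (L - kη)`
(the analogue of `GiantStepCycle.start_ge_of_lt`). [cite: Jozsa2003, §7 Prop. 32, §9 (proof of Thm. 5)] -/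
theorem kgap_start_ge_of_lt (hrho : ∀ m, W.rho (lab m) = lab (m + 1))
    (hghat : ∀ m, |(W.ghat (lab m) : ℝ) - (P (m + 1) - P m)| ≤ η)
    (hgap : ∀ m, L ≤ P (m + k) - P m) (hunit : lab 0 = W.unit) (j : ℕ)
    (h : ∀ i < k * j, (W.start i).2 < 2 * W.K + 1) :
    (j : ℝ) * (L - k * η) ≤ ((W.start (k * j)).2 : ℝ) := by
  induction j with
  | zero => simp [start]
  | succ j ih =>
    have h' : ∀ i < k * j, (W.start i).2 < 2 * W.K + 1 :=
      fun i hi => h i (lt_of_lt_of_le hi (Nat.mul_le_mul_left k (Nat.le_succ j)))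
    -- the rounds `k j, …, k j + k - 1` are not frozen, hence plain baby steps
    have hrun : ∀ i ≤ k, W.start (k * j + i) = (W.babyStep)^[i] (W.start (k * j)) := by
      intro i hi
      induction i with
      | zero => simp
      | succ i ih2 =>
        have hlt : k * j + i < k * (j + 1) := by rw [Nat.mul_succ]; omega
        rw [show k * j + (i + 1) = (k * j + i) + 1 by ring, start, Function.iterate_succ_apply', ← start,
          startStep, if_pos (h _ hlt), ih2 (by omega), Function.iterate_succ_apply' W.babyStep i]
    rw [show k * (j + 1) = k * j + k by ring, hrun k le_rfl]
    have hge := W.kgap_babySteps_ge hrho hghat hgap (W.start_fst_mem hrho hunit (k * j))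
    have ih' := ih h'
    push_cast
    linarith

/-- **The start-up freezes** (the analogue of `GiantStepCycle.le_start`): whenever
`2K + 1 ≤ j (L - kη)` and `k j ≤ s₀`, the start-up state has computed distance `≥ 2K + 1`.
[cite: Jozsa2003, §9 (proof of Thm. 5)] -/
theorem kgap_le_start (hrho : ∀ m, W.rho (lab m) = lab (m + 1))
    (hghat : ∀ m, |(W.ghat (lab m) : ℝ) - (P (m + 1) - P m)| ≤ η)
    (hgap : ∀ m, L ≤ P (m + k) - P m) (hunit : lab 0 = W.unit) {j s₀ : ℕ}
    (hj : (2 * W.K + 1 : ℝ) ≤ j * (L - k * η)) (hs : k * j ≤ s₀) :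
    2 * W.K + 1 ≤ (W.start s₀).2 := by
  by_contra hcon
  push Not at hcon
  have hpersist : ∀ i i', i ≤ i' → 2 * W.K + 1 ≤ (W.start i).2 → 2 * W.K + 1 ≤ (W.start i').2 := by
    intro i i' hii' hi
    induction i' with
    | zero =>
      have : i = 0 := by omega
      subst this; exact hi
    | succ i' ih =>
      rcases Nat.eq_or_lt_of_le hii' with h | h
      · rw [← h]; exact hi
      · have := ih (by omega)
        rw [start, Function.iterate_succ_apply', ← start, W.startStep_of_le' this]; exact this
  have hall : ∀ i < k * j, (W.start i).2 < 2 * W.K + 1 := by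
    intro i hi
    by_contra hc
    push Not at hc
    exact absurd (hpersist i s₀ (by omega) hc) (not_le.mpr hcon)
  have hge := W.kgap_start_ge_of_lt hrho hghat hgap hunit j hall
  have hlt : (W.start (k * j)).2 < 2 * W.K + 1 := by
    by_contra hc; push Not at hc
    exact absurd (hpersist _ s₀ hs hc) (not_le.mpr hcon)
  have : ((W.start (k * j)).2 : ℝ) < 2 * W.K + 1 := by exact_mod_cast hlt
  linarith

/-! ### Phase C with a `k`-gap: `k M` final rounds -/

/-- Before freezing, the final walk is plain iteration of `ρ` (as
`GiantStepCycle.iterate_finStep_eq_of_le`, on `WalkData`). [folklore] -/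
theorem iterate_finStep_eq_of_le' {x : ℚ} {J : St ι} :
    ∀ j, (W.babyStep ((W.finStep x)^[j] J)).2 ≤ x → (W.finStep x)^[j] J = (W.babyStep)^[j] J := by
  intro j
  induction j with
  | zero => intro; rfl
  | succ j ih =>
    intro hj
    have hj' : (W.babyStep ((W.finStep x)^[j] J)).2 ≤ x := by
      by_contra hc
      push Not at hc
      have hfix : (W.finStep x)^[j + 1] J = (W.finStep x)^[j] J := by
        rw [Function.iterate_succ_apply', finStep, if_neg (not_le.mpr hc)]
      rw [hfix] at hj
      exact absurd hj (not_le.mpr hc)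
    rw [Function.iterate_succ_apply', ih hj', finStep, if_pos, Function.iterate_succ_apply']
    rwa [ih hj'] at hj'

/-- The final rounds never pass the target (as `GiantStepCycle.final_le`, on `WalkData`, from a
descent state at or left of the target). [cite: Jozsa2003, §9 ("ensuring each time to stay to the left of x")] -/
theorem iterate_finStep_le {x : ℚ} {J : St ι} (hJ : J.2 ≤ x) (B : ℕ) : ((W.finStep x)^[B] J).2 ≤ x := by
  induction B with
  | zero => exact hJ
  | succ B ih =>
    rw [Function.iterate_succ_apply']
    unfold finStep
    split_ifs with h
    · exact h
    · exact ih

/-- **The walk ends just left of the target** (the analogue of `GiantStepCycle.lt_final_babyStep`):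
if the descent ends at an ideal of the cycle at or left of `x` with residual `≤ Res`, and
`M (L - kη) > Res`, then after `B = k M` final rounds the next baby step would pass `x`.
[cite: Jozsa2003, §9 (proof of Thm. 5: "I_x will certainly be either J' or ρ(J')")] -/
theorem kgap_lt_final_babyStep (hrho : ∀ m, W.rho (lab m) = lab (m + 1))
    (hghat : ∀ m, |(W.ghat (lab m) : ℝ) - (P (m + 1) - P m)| ≤ η)
    (hgap : ∀ m, L ≤ P (m + k) - P m) {x : ℚ} {s₀ T M : ℕ} {Res : ℝ}
    (hlab : ∃ m, lab m = (W.descent x s₀ T).1) (hle : (W.descent x s₀ T).2 ≤ x)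
    (hres : (x : ℝ) - (W.descent x s₀ T).2 ≤ Res) (hM : Res < M * (L - k * η)) :
    x < (W.babyStep (W.final x s₀ T (k * M))).2 := by
  by_contra hcon
  push Not at hcon
  unfold final at hcon
  have heq := W.iterate_finStep_eq_of_le' (x := x) (J := W.descent x s₀ T) (k * M) hcon
  have hge := W.kgap_iterate_babyStep_ge hrho hghat hgap hlab M
  rw [← heq] at hge
  have hle' : (((W.finStep x)^[k * M] (W.descent x s₀ T)).2 : ℝ) ≤ x := by
    exact_mod_cast W.iterate_finStep_le hle (k * M)
  linarith

end WalkData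

/-! ### The `k`-gap in the candidate check and in the counting of ideals -/

section Positions

variable {P : ℤ → ℝ} {L R : ℝ} {k n : ℕ}

/-- **The index window of the candidate check** (the `k`-gap analogue of the use of `two_gap` in
`GiantStepCycle.passes_complete`): a position `P t` with `P m < P t < P (m + 1) + L` has
`m < t ≤ m + k`; so the unit ideal at distance `lR` is found among the shifts `j ≤ k` after the walk
to `x - Δ`. [cite: Jozsa2003, §10 (c)] -/
theorem kgap_window (hmono : StrictMono P) (hgap : ∀ m, L ≤ P (m + k) - P m) {m t : ℤ}
    (h1 : P m < P t) (h2 : P t < P (m + 1) + L) : m < t ∧ t ≤ m + k := by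
  refine ⟨hmono.lt_iff_lt.mp h1, ?_⟩
  by_contra h
  push Not at h
  have h3 : m + 1 + k ≤ t := by omega
  have h4 := hmono.monotone h3
  have h5 := hgap (m + 1)
  linarith

/-- `l` periods further is `l R` further (natural `l`). [folklore] -/
theorem P_add_nat_mul_period (hper : ∀ m, P (m + n) = P m + R) (m : ℤ) (l : ℕ) :
    P (m + l * n) = P m + l * R := by
  induction l with
  | zero => simp
  | succ l ih =>
    rw [show m + ((l + 1 : ℕ) : ℤ) * n = (m + l * n) + n by push_cast; ring, hper, ih]
    push_cast; ring

/-- Summing the `k`-gap: `t L ≤ P (t k) - P 0`. [folklore] -/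
theorem kgap_sum_le (hgap : ∀ m, L ≤ P (m + k) - P m) (t : ℕ) : (t : ℝ) * L ≤ P ((t : ℤ) * k) - P 0 := by
  induction t with
  | zero => simp
  | succ t ih =>
    have h := hgap (t * k)
    rw [show ((t + 1 : ℕ) : ℤ) * k = t * k + k by push_cast; ring]
    push_cast
    linarith

/-- **At most `k R / L` ideals per period**: `n L ≤ k R` (for the quadratic principal cycle this is
Jozsa's `p ln 2 ≤ 2R`; for the cubic chain `n ln 2 ≤ 6R`). [cite: Jozsa2003, §7 Prop. 32] [cite: BuchmannWilliams1988Infrastructure] -/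
theorem kgap_count (hper : ∀ m, P (m + n) = P m + R) (hgap : ∀ m, L ≤ P (m + k) - P m) :
    (n : ℝ) * L ≤ k * R := by
  have h1 := kgap_sum_le hgap n
  have h2 := P_add_nat_mul_period hper 0 k
  rw [zero_add, show ((k : ℕ) : ℤ) * (n : ℤ) = (n : ℤ) * k by ring] at h2
  linarith

/-- **The regulator is at least `L / k`**: `L ≤ k R` as soon as there is an ideal (`n ≥ 1`) and
`L ≥ 0`. [cite: Jozsa2003, §7 Prop. 32] -/
theorem kgap_le_mul_R (hper : ∀ m, P (m + n) = P m + R) (hgap : ∀ m, L ≤ P (m + k) - P m)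
    (hn : 0 < n) (hL : 0 ≤ L) : L ≤ k * R := by
  have h1 : (1 : ℝ) ≤ n := by exact_mod_cast hn
  have h2 := kgap_count hper hgap
  nlinarith

end Positions

/-! ### The case `k = 2`: the tree's `GiantStepCycle` supplies the hypotheses -/

namespace GiantStepCycle

variable {ι : Type*} (C : GiantStepCycle ι)

/-- The double-gap axiom is the `k`-gap with `k = 2`. [cite: Jozsa2003, §7 Prop. 32] -/
theorem kgap_two : ∀ m, C.L ≤ C.P (m + (2 : ℕ)) - C.P m := fun m => by exact_mod_cast C.two_gap m

/-- The number of ideals per period is at most `2R / L` (new even for the quadratic cycle, where it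
reads `p ln 2 ≤ 2 R`). [cite: Jozsa2003, §7 Prop. 32] -/
theorem card_mul_L_le_two_mul_R : (C.n : ℝ) * C.L ≤ 2 * C.R := by
  have h := kgap_count (P := C.P) (n := C.n) (k := 2) C.periodic C.kgap_two
  simpa using h

end GiantStepCycle

end Literature.Computability.Cryptography

end
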